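import Summits.CriticalPhenomena.PercolationContinuityZ3.Theorems.PercNearOneGluingNoHeavyLowerTailIncStarApexForestConcave
import HarnessLib

/-!
# FC♯: concavity of the increasing star along the pairs of a target-free two-terminal piece (FC up to blob substitution)

Support file for the Sahi programme (`--supports stmt-CriticalPhenomena-4575`, prover prim-sahi-p2 gen 20).  No definitions, no named
facts, no sorries; standard axioms.  Memo `run/shared/lean/prim/prim-sahi/prim-sahi-p2/PROOF-E3.md` (30j); lead g120 §9 (B-cyc).

THEOREM FC (`…IncStarApexForestConcave`) says that on an apex-forest Sahi's cubic `E₃({s↔a},{s↔b},{s↔c})` is concave along every pair.  The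
two-terminal BLOB REDUCTION (`…SahiBlobReduction`) transports it: let `B ∌ s, a, b, c` be a vertex set whose only exits are two terminals
`u ≠ v` (no positive pair from `B` to the outside of `B ∪ {u, v}`; `u = s` allowed), and let `W` be `w` switched off on the pairs meeting `B`.
* `incStar_blob_transfer₂` — for every pair `e = s(x,t)` with `x ∈ B`, `t ∈ {u, v} ∪ B`, `t ≠ x`:  `E₃(w[e↦q]) = E₃(W[s(u,v)↦r(q)])` with
  `r(q) = (1−q)θ₀ + qθ₁`, `θ₀ ≤ θ₁` (general-terminal version of `IncStar.incStar_blob_transfer`).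
* `incStar_blobPair_threePoint` — **if the environment of `W` with `s(u,v)` switched on is acyclic, then `q ↦ E₃(w[e↦q])` is CONCAVE on
  `[0,1]` (three-point form) along every such pair `e`.**  In particular (B-cyc, lobe case): on 'apex + one cycle', every cycle edge is a
  concavity direction as soon as the cycle together with everything hanging on it is target-free and has at most two exits (one of which may
  be the root); the open core of CONJECTURE B-cyc is the cycle with three essential ports.
-/

noncomputable section

namespace Summit.CriticalPhenomena.PercolationContinuityZ3.Theorems

namespace IncStar

open MeasureTheory Set Literature.Probability.Percolation Literature.Probability.LatticeModels
open scoped Classical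

variable {n : ℕ}

/-- **Blob reparametrisation, general terminals.**  `B ∌ s, a, b, c` with exits only to `u ≠ v` (`u, v ∉ B`), `e = s(x, t)` with `x ∈ B`
and `t ∈ {u, v} ∪ B`: `E₃(w[e↦q]) = E₃(W[s(u,v)↦r])`, `r = (1−q)θ₀ + qθ₁`, `θ₀ ≤ θ₁`, `W = w` off the pairs meeting `B`. [this work] -/
theorem incStar_blob_transfer₂ (w : Sym2 (Fin n) → unitInterval) (B : Finset (Fin n)) {s u v x t a b c : Fin n}
    (hsB : s ∉ B) (huB : u ∉ B) (hvB : v ∉ B) (huv : u ≠ v) (hxB : x ∈ B) (ht : t = u ∨ t = v ∨ t ∈ B)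
    (hw : ∀ x' ∈ B, ∀ z, z ∉ B → z ≠ u → z ≠ v → w s(x', z) = 0)
    (ha : a ∉ B) (hb : b ∉ B) (hc : c ∉ B) :
    ∃ θ₀ θ₁ : ℝ, θ₀ ≤ θ₁ ∧ ∀ q : unitInterval, ∃ r : unitInterval,
      (r : ℝ) = (1 - (q : ℝ)) * θ₀ + (q : ℝ) * θ₁ ∧
      sahiE3 (prodBernoulli (Function.update w s(x, t) q)) (openConn s a) (openConn s b) (openConn s c)
        = sahiE3 (prodBernoulli (Function.update (fun z => if (∃ x' ∈ B, x' ∈ z) then 0 else w z) s(u, v) r)) (openConn s a) (openConn s b) (openConn s c) := by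
  -- the blob network: pairs meeting `B`, plus `s(u, v)`
  obtain ⟨N, hN⟩ : ∃ N : Sym2 (Fin n) → unitInterval,
      ∀ e', N e' = if (∃ x' ∈ B, x' ∈ e') ∨ e' = s(u, v) then w e' else 0 := ⟨_, fun _ => rfl⟩
  have heB : ∃ x' ∈ B, x' ∈ s(x, t) := ⟨x, hxB, Sym2.mem_mk_left x t⟩
  refine ⟨(prodBernoulli (Function.update N s(x, t) 0)).real (openConn u v),
    (prodBernoulli (Function.update N s(x, t) 1)).real (openConn u v),
    tieLiftOne_real_zero_le_one N s(x, t) (isUpperSet_openConn u v), fun q => ?_⟩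
  have hr0 : 0 ≤ (prodBernoulli (Function.update N s(x, t) q)).real (openConn u v) := measureReal_nonneg
  have hr1 : (prodBernoulli (Function.update N s(x, t) q)).real (openConn u v) ≤ 1 := measureReal_le_one
  refine ⟨⟨_, Set.mem_Icc.2 ⟨hr0, hr1⟩⟩, HullPort.real_update_affine N s(x, t) q (openConn u v), ?_⟩
  refine SahiBlobReduction.sahiE3_incStar_blobReduce (Function.update w s(x, t) q)
    (Function.update (fun z => if (∃ x' ∈ B, x' ∈ z) then 0 else w z) s(u, v) ⟨_, Set.mem_Icc.2 ⟨hr0, hr1⟩⟩) B huB hvB huv hsB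
    ?_ ?_ ?_ ?_ ha hb hc
  · -- no positive pair leaves the blob except through the terminals
    intro x' hx' z hzB hzu hzv
    have hne : s(x', z) ≠ s(x, t) := by
      intro h
      rw [Sym2.eq_iff] at h
      rcases h with ⟨-, h2⟩ | ⟨h1, h2⟩
      · rcases ht with ht | ht | ht
        · exact hzu (h2.trans ht)
        · exact hzv (h2.trans ht)
        · exact hzB (h2 ▸ ht)
      · exact hzB (h2 ▸ hxB)
    rw [Function.update_of_ne hne]
    exact hw x' hx' z hzB hzu hzv
  · -- the reduced weight vanishes on the pairs meeting `B`
    intro x' hx' z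
    have hne : s(x', z) ≠ s(u, v) := by
      intro h
      rw [Sym2.eq_iff] at h
      rcases h with ⟨h1, -⟩ | ⟨h1, -⟩
      · exact huB (h1 ▸ hx')
      · exact hvB (h1 ▸ hx')
    rw [Function.update_of_ne hne]
    exact if_pos ⟨x', hx', Sym2.mem_mk_left x' z⟩
  · -- and agrees with `w[e↦q]` off the blob
    intro e' he'B he'f
    have hne : e' ≠ s(x, t) := by
      obtain ⟨x', hx', hx'e⟩ := heB
      exact fun h => he'B x' hx' (h ▸ hx'e)
    rw [Function.update_of_ne he'f, Function.update_of_ne hne]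
    exact if_neg (by push Not; exact he'B)
  · -- the new weight of `s(u, v)` is the blob's two-terminal probability under `w[e↦q]`
    rw [Function.update_self]
    change (prodBernoulli (Function.update N s(x, t) q)).real (openConn u v) = _
    refine congrArg (fun μ : Measure (BondConfig (Fin n)) => μ.real (openConn u v)) (congrArg prodBernoulli ?_)
    funext e'
    by_cases h' : e' = s(x, t)
    · subst h'
      rw [Function.update_self, Function.update_self, if_pos (Or.inl heB)]
    · rw [Function.update_of_ne h', Function.update_of_ne h', hN e']
      by_cases hc' : (∃ x' ∈ B, x' ∈ e') ∨ e' = s(u, v)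
      · simp only [if_pos hc']
      · simp only [if_neg hc']

/-- **FC♯ (FC up to blob substitution).**  In the setting of `incStar_blob_transfer₂`, if the environment of `W` (= `w` switched off on the
pairs meeting `B`) with the terminal pair `s(u,v)` switched on is acyclic, then `E₃` of the increasing star is concave (three-point form) along
every pair `e = s(x,t)` meeting `B` (`x ∈ B`, `t ∈ {u,v} ∪ B`, `t ≠ x`).  Covers the cycle edges of 'apex + one cycle' whenever the cycle region
is target-free with at most two exits. [this work] -/
theorem incStar_blobPair_threePoint (w : Sym2 (Fin n) → unitInterval) (B : Finset (Fin n)) {s u v x t a b c : Fin n}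
    (hsB : s ∉ B) (huB : u ∉ B) (hvB : v ∉ B) (huv : u ≠ v) (hxB : x ∈ B) (ht : t = u ∨ t = v ∨ t ∈ B)
    (hw : ∀ x' ∈ B, ∀ z, z ∉ B → z ≠ u → z ≠ v → w s(x', z) = 0)
    (ha : a ∉ B) (hb : b ∉ B) (hc : c ∉ B)
    (hW : (SimpleGraph.fromEdgeSet {z : Sym2 (Fin n) | s ∉ z ∧
      Function.update (fun z => if (∃ x' ∈ B, x' ∈ z) then 0 else w z) s(u, v) 1 z ≠ 0}).IsAcyclic)
    (p₀ p p₁ : unitInterval) (h01 : p₀ ≤ p) (h12 : p ≤ p₁) :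
    ((p₁ : ℝ) - (p : ℝ)) * sahiE3 (prodBernoulli (Function.update w s(x, t) p₀)) (openConn s a) (openConn s b) (openConn s c)
      + ((p : ℝ) - (p₀ : ℝ)) * sahiE3 (prodBernoulli (Function.update w s(x, t) p₁)) (openConn s a) (openConn s b) (openConn s c)
    ≤ ((p₁ : ℝ) - (p₀ : ℝ)) * sahiE3 (prodBernoulli (Function.update w s(x, t) p)) (openConn s a) (openConn s b) (openConn s c) := by
  have h01' : (p₀ : ℝ) ≤ p := h01
  have h12' : (p : ℝ) ≤ p₁ := h12
  have huv' : ¬ (s(u, v)).IsDiag := by rw [Sym2.mk_isDiag_iff]; exact huv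
  obtain ⟨θ₀, θ₁, hθ, hq⟩ := incStar_blob_transfer₂ w B hsB huB hvB huv hxB ht hw ha hb hc
  obtain ⟨r₀, hr₀, E0⟩ := hq p₀
  obtain ⟨r, hr, E⟩ := hq p
  obtain ⟨r₁, hr₁, E1⟩ := hq p₁
  rw [E0, E, E1]
  set W : Sym2 (Fin n) → unitInterval := fun z => if (∃ x' ∈ B, x' ∈ z) then 0 else w z with hWdef
  have hk : 0 ≤ θ₁ - θ₀ := sub_nonneg.2 hθ
  have h01r : r₀ ≤ r := by
    have h1 : (0 : ℝ) ≤ ((p : ℝ) - p₀) * (θ₁ - θ₀) := mul_nonneg (sub_nonneg.2 h01') hk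
    have h2 : (r₀ : ℝ) ≤ r := by rw [hr₀, hr]; linarith
    exact_mod_cast h2
  have h12r : r ≤ r₁ := by
    have h1 : (0 : ℝ) ≤ ((p₁ : ℝ) - p) * (θ₁ - θ₀) := mul_nonneg (sub_nonneg.2 h12') hk
    have h2 : (r : ℝ) ≤ r₁ := by rw [hr, hr₁]; linarith
    exact_mod_cast h2
  have key := incStar_pair_threePoint_of_apexForest W s a b c s(u, v) huv' hW r₀ r r₁ h01r h12r
  have e0 : (r₀ : ℝ) = θ₀ + (p₀ : ℝ) * (θ₁ - θ₀) := by rw [hr₀]; ring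
  have e : (r : ℝ) = θ₀ + (p : ℝ) * (θ₁ - θ₀) := by rw [hr]; ring
  have e1 : (r₁ : ℝ) = θ₀ + (p₁ : ℝ) * (θ₁ - θ₀) := by rw [hr₁]; ring
  refine threePoint_transfer_real (θ := θ₀) hk ?_ fun hk0 => ?_
  · rw [← e0, ← e, ← e1]
    exact key
  · have hθ' : θ₁ = θ₀ := by linarith
    have h1 : r₀ = r := Subtype.ext (by rw [hr₀, hr, hθ']; ring)
    have h2 : r₁ = r := Subtype.ext (by rw [hr₁, hr, hθ']; ring)
    rw [h1, h2]
    exact ⟨rfl, rfl⟩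

end IncStar

end Summit.CriticalPhenomena.PercolationContinuityZ3.Theorems
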